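import Summits.MatrixMultiplication.OmegaCensus.STPP222CubeReflect
import Summits.MatrixMultiplication.OmegaCensus.STPP222SqCover

/-!
# ω-census, the pattern `(2,2,2)³`: normal form, symmetries and the assembly theorem for kernel NON-existence proofs

HONEST FRAMING (pub-omega census; verbatim): lottery ticket; floor = certified bounds/negative ranges.
Census STRUCTURE bookkeeping (question Q7, row `k = 3`: the lower half `n₃ ≥ 32`), not progress on `ω`.

The `N = 3` analogue of `STPP222SqCover.lean` for the mask engine: given a finite abelian group `G` with an encoding
`E : Enc3 G` (`STPP222CubeClauses.lean`), this file turns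
* a kernel-evaluated search certificate `searchB3 E.A el reps = true` with its `q₁`-coverage check, and
* the two kernel-decided COVERING facts of `STPP222SqCover.lean` (every nonzero element is moved into `R1` by a listed
  injective endomorphism up to sign; the canonical start triple of every `(a, dB, dC)`, `a ∈ R1`, clearing the start
  guard is a start of `reps`) — the canonical triple `canon` and the candidates are those of the `N = 2` file, read
  through `Enc3.toEnc`,
into «`G` admits no three simultaneous-TPP triples of 2-subsets» (`not_exists_of_cover3`).  Symmetries used, all proved
from CKSU Def. 5.1: per-triple translation with global `B`/`C` shifts and the role swap `B ↔ C` (`N = 2` files, any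
`N`), injective additive maps (tree `IsSTPP.image`), re-indexing of the triples (`isSTPP_reindex`, for the swap of
triples 1 and 2 demanded by the search's ordering), and the normal form `exists_nf3`.

References: H. Cohn, R. Kleinberg, B. Szegedy, C. Umans, FOCS 2005 (arXiv:math/0511460), Def. 5.1.
Record: pub-omega HOME `pub-omega-eng2/results/c4red/K2-THRESHOLD-eng2.md` §NEG3 (ENG2 gen 18, 2026-08-23).
-/

open Literature.Computability.AlgebraicComplexity Finset

namespace Summit.MatrixMultiplication.OmegaCensus

namespace STPP222CubeNeg

open STPP222SqNeg (sg exists_oriented cands canon canon_mem_cands exists_of_mem_cands qcovB exists_qs_of_qcovB withQs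
  memTriple exists_qs_of_memTriple isSTPP_translate isSTPP_swapBC)

/-! ## 1. The encoding as an `N = 2` code structure (to reuse `canon`, `cands`) -/

/-- The `N = 2` code structure of an encoding: codes `ℕ`, `key = id`, binary operations through `reduce`. -/
def Enc3.toEnc {G : Type} [AddCommGroup G] (E : Enc3 G) : STPP222SqNeg.Enc G ℕ where
  ops := ⟨fun x y => E.A.reduce (E.A.off + x - y), fun x y => E.A.reduce (x + y), 0⟩
  enc := E.enc
  key := id
  enc_sub x y := by
    have h := E.reduce_sum [x] [y] (by simp) (by simp)
    simp only [List.length_singleton, Nat.mul_one, List.map_cons, List.map_nil, List.sum_cons, List.sum_nil,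
      add_zero] at h
    exact h.symm
  enc_add x y := by
    have h := E.reduce_sum [x, y] [] (by simp) (by simp)
    simp only [List.length_nil, Nat.mul_zero, List.map_cons, List.map_nil, List.sum_cons, List.sum_nil, Nat.zero_add,
      Nat.sub_zero, sub_zero, add_zero] at h
    exact h.symm
  enc_zero := E.enc_zero
  enc_inj := E.enc_inj
  key_inj := E.enc_inj

/-! ## 2. Re-indexing the triples -/

/-- Re-indexing the triples along an injective map preserves the STPP. [cite: CohnKleinbergSzegedyUmans2005, Def. 5.1] -/
theorem isSTPP_reindex {G : Type} [AddCommGroup G] {N M : ℕ} {A B C : Fin N → Finset G} (hS : IsSTPP A B C)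
    {σ : Fin M → Fin N} (hσ : Function.Injective σ) : IsSTPP (fun t => A (σ t)) (fun t => B (σ t)) (fun t => C (σ t)) := by
  intro i j k s hs s' hs' t ht t' ht' u hu u' hu' h0
  obtain ⟨hij, hjk, e1, e2, e3⟩ := hS (σ i) (σ j) (σ k) s hs s' hs' t ht t' ht' u hu u' hu' h0
  exact ⟨hσ hij, hσ hjk, e1, e2, e3⟩

/-- The swap of triples 1 and 2. -/
def swap12 : Fin 3 → Fin 3 := ![0, 2, 1]

/-- `swap12` is injective. -/
theorem swap12_inj : Function.Injective swap12 := by decide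

/-- The swap of triples 1 and 2 on the variables. -/
def V13.swap : V13 → V13
  | .a0 => .a0 | .b0 => .b0 | .c0 => .c0 | .q1 => .q2 | .r1 => .r2 | .q1' => .q2' | .r1' => .r2' | .a1 => .a2
  | .q2 => .q1 | .r2 => .r1 | .q2' => .q1' | .r2' => .r1' | .a2 => .a1

/-- The swap of triples 1 and 2 on triple indices. -/
def T3.swap : T3 → T3
  | .t0 => .t0 | .t1 => .t2 | .t2 => .t1

/-- Entries of the swapped assignment (`A`). -/
theorem gA_swap {G : Type} [AddCommGroup G] (val : V13 → G) (t : T3) (e : Bool) :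
    gA (val ∘ V13.swap) t e = gA val t.swap e := by cases t <;> cases e <;> rfl

/-- Entries of the swapped assignment (`B`). -/
theorem gB_swap {G : Type} [AddCommGroup G] (val : V13 → G) (t : T3) (e : Bool) :
    gB (val ∘ V13.swap) t e = gB val t.swap e := by cases t <;> cases e <;> rfl

/-- Entries of the swapped assignment (`C`). -/
theorem gC_swap {G : Type} [AddCommGroup G] (val : V13 → G) (t : T3) (e : Bool) :
    gC (val ∘ V13.swap) t e = gC val t.swap e := by cases t <;> cases e <;> rfl

/-- The normal form is preserved by the swap of triples 1 and 2. -/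
theorem NF.swap {G : Type} [AddCommGroup G] {SA SB SC : Fin 3 → Finset G} {val : V13 → G} (h : NF SA SB SC val) :
    NF (fun t => SA (swap12 t)) (fun t => SB (swap12 t)) (fun t => SC (swap12 t)) (val ∘ V13.swap) where
  memA t e := by rw [gA_swap, show swap12 (fin3 t) = fin3 t.swap by cases t <;> rfl]; exact h.memA _ _
  memB t e := by rw [gB_swap, show swap12 (fin3 t) = fin3 t.swap by cases t <;> rfl]; exact h.memB _ _
  memC t e := by rw [gC_swap, show swap12 (fin3 t) = fin3 t.swap by cases t <;> rfl]; exact h.memC _ _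
  injA t e₁ e₂ he := h.injA t.swap e₁ e₂ (by rwa [gA_swap, gA_swap] at he)
  injB t e₁ e₂ he := h.injB t.swap e₁ e₂ (by rwa [gB_swap, gB_swap] at he)
  injC t e₁ e₂ he := h.injC t.swap e₁ e₂ (by rwa [gC_swap, gC_swap] at he)

/-! ## 3. Normal form -/

/-- The assignment of the 13 unknowns read off chosen elements: differences for `A t`, `B 0`, `C 0`, translated
elements for `B t`, `C t` (`t = 1, 2`). -/
def nfVal {G : Type} [AddCommGroup G] (x₀ x₁ y₀ y₁ z₀ z₁ m₀ m₁ n₀ n₁ k₀ k₁ o₀ o₁ p₀ p₁ l₀ l₁ : G) : V13 → G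
  | .a0 => x₁ - x₀
  | .b0 => m₁ - m₀
  | .c0 => o₁ - o₀
  | .q1 => n₀ - (y₀ + (m₀ - x₀))
  | .r1 => p₀ - (y₀ + (o₀ - x₀))
  | .q1' => n₁ - (y₀ + (m₀ - x₀))
  | .r1' => p₁ - (y₀ + (o₀ - x₀))
  | .a1 => y₁ - y₀
  | .q2 => k₀ - (z₀ + (m₀ - x₀))
  | .r2 => l₀ - (z₀ + (o₀ - x₀))
  | .q2' => k₁ - (z₀ + (m₀ - x₀))
  | .r2' => l₁ - (z₀ + (o₀ - x₀))
  | .a2 => z₁ - z₀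

/-- NORMAL FORM.  From an STPP family and two distinct chosen elements of each of its nine sets (`x` in `A 0`, `y` in
`A 1`, `z` in `A 2`, `m` in `B 0`, `n` in `B 1`, `k` in `B 2`, `o` in `C 0`, `p` in `C 1`, `l` in `C 2`), the
translated family (`isSTPP_translate` with `g = (x₀, y₀, z₀)`, `β = m₀ − x₀`, `γ = o₀ − x₀`) is an STPP family in
membership normal form for the assignment `nfVal …`. [cite: CohnKleinbergSzegedyUmans2005, Def. 5.1] -/
theorem exists_nf3 {G : Type} [AddCommGroup G] [DecidableEq G] {A B C : Fin 3 → Finset G} (hS : IsSTPP A B C)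
    {x₀ x₁ y₀ y₁ z₀ z₁ m₀ m₁ n₀ n₁ k₀ k₁ o₀ o₁ p₀ p₁ l₀ l₁ : G}
    (hx₀ : x₀ ∈ A 0) (hx₁ : x₁ ∈ A 0) (hx : x₀ ≠ x₁) (hy₀ : y₀ ∈ A 1) (hy₁ : y₁ ∈ A 1) (hy : y₀ ≠ y₁)
    (hz₀ : z₀ ∈ A 2) (hz₁ : z₁ ∈ A 2) (hz : z₀ ≠ z₁) (hm₀ : m₀ ∈ B 0) (hm₁ : m₁ ∈ B 0) (hm : m₀ ≠ m₁)
    (hn₀ : n₀ ∈ B 1) (hn₁ : n₁ ∈ B 1) (hn : n₀ ≠ n₁) (hk₀ : k₀ ∈ B 2) (hk₁ : k₁ ∈ B 2) (hk : k₀ ≠ k₁)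
    (ho₀ : o₀ ∈ C 0) (ho₁ : o₁ ∈ C 0) (ho : o₀ ≠ o₁) (hp₀ : p₀ ∈ C 1) (hp₁ : p₁ ∈ C 1) (hp : p₀ ≠ p₁)
    (hl₀ : l₀ ∈ C 2) (hl₁ : l₁ ∈ C 2) (hl : l₀ ≠ l₁) :
    ∃ A' B' C' : Fin 3 → Finset G, IsSTPP A' B' C' ∧
      NF A' B' C' (nfVal x₀ x₁ y₀ y₁ z₀ z₁ m₀ m₁ n₀ n₁ k₀ k₁ o₀ o₁ p₀ p₁ l₀ l₁) := by
  let g : Fin 3 → G := ![x₀, y₀, z₀]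
  refine ⟨fun t => (A t).image (· - g t), fun t => (B t).image (· - (g t + (m₀ - x₀))),
    fun t => (C t).image (· - (g t + (o₀ - x₀))), isSTPP_translate hS g _ _, ?_⟩
  constructor
  · intro t e
    cases t <;> cases e
    · exact Finset.mem_image.2 ⟨x₀, hx₀, by simp [g, gA, oval, slotA, fin3]⟩
    · exact Finset.mem_image.2 ⟨x₁, hx₁, by simp [g, gA, oval, slotA, nfVal, fin3]⟩
    · exact Finset.mem_image.2 ⟨y₀, hy₀, by simp [g, gA, oval, slotA, fin3]⟩
    · exact Finset.mem_image.2 ⟨y₁, hy₁, by simp [g, gA, oval, slotA, nfVal, fin3]⟩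
    · exact Finset.mem_image.2 ⟨z₀, hz₀, by simp [g, gA, oval, slotA, fin3]⟩
    · exact Finset.mem_image.2 ⟨z₁, hz₁, by simp [g, gA, oval, slotA, nfVal, fin3]⟩
  · intro t e
    cases t <;> cases e
    · exact Finset.mem_image.2 ⟨m₀, hm₀, by simp [g, gB, oval, slotB, fin3]⟩
    · exact Finset.mem_image.2 ⟨m₁, hm₁, by simp [g, gB, oval, slotB, nfVal, fin3]⟩
    · exact Finset.mem_image.2 ⟨n₀, hn₀, by simp [g, gB, oval, slotB, nfVal, fin3]⟩
    · exact Finset.mem_image.2 ⟨n₁, hn₁, by simp [g, gB, oval, slotB, nfVal, fin3]⟩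
    · exact Finset.mem_image.2 ⟨k₀, hk₀, by simp [g, gB, oval, slotB, nfVal, fin3]⟩
    · exact Finset.mem_image.2 ⟨k₁, hk₁, by simp [g, gB, oval, slotB, nfVal, fin3]⟩
  · intro t e
    cases t <;> cases e
    · exact Finset.mem_image.2 ⟨o₀, ho₀, by simp [g, gC, oval, slotC, fin3]⟩
    · exact Finset.mem_image.2 ⟨o₁, ho₁, by simp [g, gC, oval, slotC, nfVal, fin3]⟩
    · exact Finset.mem_image.2 ⟨p₀, hp₀, by simp [g, gC, oval, slotC, nfVal, fin3]⟩
    · exact Finset.mem_image.2 ⟨p₁, hp₁, by simp [g, gC, oval, slotC, nfVal, fin3]⟩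
    · exact Finset.mem_image.2 ⟨l₀, hl₀, by simp [g, gC, oval, slotC, nfVal, fin3]⟩
    · exact Finset.mem_image.2 ⟨l₁, hl₁, by simp [g, gC, oval, slotC, nfVal, fin3]⟩
  · intro t e₁ e₂ he
    cases t <;> cases e₁ <;> cases e₂ <;> simp only [gA, oval, slotA, nfVal] at he <;> first
      | rfl | exact absurd (sub_eq_zero.1 he.symm) (Ne.symm hx) | exact absurd (sub_eq_zero.1 he) (Ne.symm hx)
      | exact absurd (sub_eq_zero.1 he.symm) (Ne.symm hy) | exact absurd (sub_eq_zero.1 he) (Ne.symm hy)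
      | exact absurd (sub_eq_zero.1 he.symm) (Ne.symm hz) | exact absurd (sub_eq_zero.1 he) (Ne.symm hz)
  · intro t e₁ e₂ he
    cases t <;> cases e₁ <;> cases e₂ <;> simp only [gB, oval, slotB, nfVal] at he <;> first
      | rfl | exact absurd (sub_eq_zero.1 he.symm) (Ne.symm hm) | exact absurd (sub_eq_zero.1 he) (Ne.symm hm)
      | exact absurd (sub_left_injective he) hn | exact absurd (sub_left_injective he).symm hn
      | exact absurd (sub_left_injective he) hk | exact absurd (sub_left_injective he).symm hk
  · intro t e₁ e₂ he
    cases t <;> cases e₁ <;> cases e₂ <;> simp only [gC, oval, slotC, nfVal] at he <;> first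
      | rfl | exact absurd (sub_eq_zero.1 he.symm) (Ne.symm ho) | exact absurd (sub_eq_zero.1 he) (Ne.symm ho)
      | exact absurd (sub_left_injective he) hp | exact absurd (sub_left_injective he).symm hp
      | exact absurd (sub_left_injective he) hl | exact absurd (sub_left_injective he).symm hl

/-! ## 4. The assembly theorem -/

/-- From a normal form with nonzero differences and ordered pairs (no condition between triples 1 and 2) to a
contradiction: order the triples 1, 2 by swapping them if necessary, then apply the reflection theorem.
[cite: CohnKleinbergSzegedyUmans2005, Def. 5.1] -/
theorem nf_contra3 {G : Type} [AddCommGroup G] (E : Enc3 G) {el : List ℕ} (hel : ∀ g : G, E.enc g ∈ el)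
    {reps : List (ℕ × ℕ × ℕ × List ℕ)} (hs : searchB3 E.A el reps = true) (hq : qcovB el reps = true)
    {SA SB SC : Fin 3 → Finset G} (hS : IsSTPP SA SB SC) {val : V13 → G} (hN : NF SA SB SC val)
    (ha0 : val .a0 ≠ 0) (ha1 : val .a1 ≠ 0) (ha2 : val .a2 ≠ 0) (hb0 : val .b0 ≠ 0) (hc0 : val .c0 ≠ 0)
    (hq1 : E.enc (val .q1) < E.enc (val .q1')) (hr1 : E.enc (val .r1) < E.enc (val .r1'))
    (hq2 : E.enc (val .q2) < E.enc (val .q2')) (hr2 : E.enc (val .r2) < E.enc (val .r2'))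
    {qs : List ℕ} (hrep : (E.enc (val .a0), E.enc (val .b0), E.enc (val .c0), qs) ∈ reps) : False := by
  by_cases hlex : E.enc (val .q1) ≤ E.enc (val .q2) ∧ (E.enc (val .q2) = E.enc (val .q1) → E.enc (val .q1') ≤ E.enc (val .q2'))
  · obtain ⟨qs', hrep', hq'⟩ := exists_qs_of_qcovB hq hrep (hel (val .q1))
    exact nf_false_of_searchB3 E hel hs hS hN ⟨ha0, ha1, ha2, hb0, hc0, hq1, hr1, hq2, hr2, hlex.1, hlex.2⟩ hrep' hq'
  · -- swap triples 1 and 2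
    have hS' := isSTPP_reindex hS swap12_inj
    have hN' := hN.swap
    have hlex' : E.enc (val .q2) ≤ E.enc (val .q1) ∧
        (E.enc (val .q1) = E.enc (val .q2) → E.enc (val .q2') ≤ E.enc (val .q1')) := by
      rw [not_and_or] at hlex
      rcases hlex with h | h
      · exact ⟨by omega, fun e => by omega⟩
      · rw [Classical.not_imp] at h; exact ⟨h.1.le, fun _ => by omega⟩
    obtain ⟨qs', hrep', hq'⟩ := exists_qs_of_qcovB hq hrep (hel (val .q2))
    exact nf_false_of_searchB3 E hel hs hS' hN'
      ⟨ha0, ha2, ha1, hb0, hc0, hq2, hr2, hq1, hr1, hlex'.1, hlex'.2⟩ hrep' hq'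

/-- Two distinct elements of a set, ordered by code. -/
theorem exists_ordered {G : Type} [AddCommGroup G] (E : Enc3 G) {S : Finset G} {u v : G} (hu : u ∈ S) (hv : v ∈ S)
    (h : u ≠ v) : ∃ q q' : G, q ∈ S ∧ q' ∈ S ∧ E.enc q < E.enc q' := by
  have hne : E.enc u ≠ E.enc v := fun e => h (E.enc_inj e)
  rcases Nat.lt_or_gt_of_ne hne with hl | hl
  · exact ⟨u, v, hu, hv, hl⟩
  · exact ⟨v, u, hv, hu, hl⟩

/-- The start guard of a genuine normal form is clear (for the cover check). -/
theorem startBad_nf {G : Type} [AddCommGroup G] (E : Enc3 G) {SA SB SC : Fin 3 → Finset G} (hS : IsSTPP SA SB SC)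
    {val : V13 → G} (hN : NF SA SB SC val) (ha0 : val .a0 ≠ 0) (hb0 : val .b0 ≠ 0) (hc0 : val .c0 ≠ 0) :
    startBad E.A (startCfg (E.enc (val .a0)) (E.enc (val .b0)) (E.enc (val .c0))) = false := by
  have hag3 : Agrees E val (startCfg (E.enc (val .a0)) (E.enc (val .b0)) (E.enc (val .c0))) 3 := by
    intro u hu
    cases u <;> first | rfl | exact absurd hu (by decide)
  rw [startBad_eq, show (startCfg (E.enc (val .a0)) (E.enc (val .b0)) (E.enc (val .c0))).a0 = E.enc (val .a0)
    from rfl, show (startCfg (E.enc (val .a0)) (E.enc (val .b0)) (E.enc (val .c0))).b0 = E.enc (val .b0) from rfl,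
    show (startCfg (E.enc (val .a0)) (E.enc (val .b0)) (E.enc (val .c0))).c0 = E.enc (val .c0) from rfl,
    linMask_clear E hS hN (p := 0) (v := .a0) rfl valid0 (agrees_mono E val hag3 (by omega))
      (testBit_one_of_ne_zero (enc_ne_zero E ha0)),
    linMask_clear E hS hN (p := 1) (v := .b0) rfl valid1 (agrees_mono E val hag3 (by omega))
      (testBit_one_of_ne_zero (enc_ne_zero E hb0)),
    linMask_clear E hS hN (p := 2) (v := .c0) rfl valid2 (agrees_mono E val hag3 (by omega))
      (testBit_one_of_ne_zero (enc_ne_zero E hc0))]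
  rfl

/-- CORE CONTRADICTION.  An STPP family with two named elements in each of its nine sets, whose oriented difference
triple `(x₁ - x₀, m₁ - m₀, o₁ - o₀)` is — when it clears the start guard — a start triple of a start list that passed
the kernel search and the `q₁`-coverage check, cannot exist. [cite: CohnKleinbergSzegedyUmans2005, Def. 5.1] -/
theorem named_contra3 {G : Type} [AddCommGroup G] [DecidableEq G] (E : Enc3 G) {el : List ℕ}
    (hel : ∀ g : G, E.enc g ∈ el) {reps : List (ℕ × ℕ × ℕ × List ℕ)} (hs : searchB3 E.A el reps = true)
    (hq : qcovB el reps = true) {A B C : Fin 3 → Finset G} (hS : IsSTPP A B C) {x₀ x₁ y₀ y₁ z₀ z₁ m₀ m₁ n₀ n₁ k₀ k₁ o₀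
      o₁ p₀ p₁ l₀ l₁ : G} (hx₀ : x₀ ∈ A 0) (hx₁ : x₁ ∈ A 0) (hx : x₀ ≠ x₁) (hy₀ : y₀ ∈ A 1) (hy₁ : y₁ ∈ A 1) (hy : y₀ ≠ y₁)
    (hz₀ : z₀ ∈ A 2) (hz₁ : z₁ ∈ A 2) (hz : z₀ ≠ z₁) (hm₀ : m₀ ∈ B 0) (hm₁ : m₁ ∈ B 0) (hm : m₀ ≠ m₁) (hn₀ : n₀ ∈ B 1)
    (hn₁ : n₁ ∈ B 1) (hn : n₀ ≠ n₁) (hk₀ : k₀ ∈ B 2) (hk₁ : k₁ ∈ B 2) (hk : k₀ ≠ k₁) (ho₀ : o₀ ∈ C 0) (ho₁ : o₁ ∈ C 0)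
    (ho : o₀ ≠ o₁) (hp₀ : p₀ ∈ C 1) (hp₁ : p₁ ∈ C 1) (hp : p₀ ≠ p₁) (hl₀ : l₀ ∈ C 2) (hl₁ : l₁ ∈ C 2) (hl : l₀ ≠ l₁)
    (hrep : startBad E.A (startCfg (E.enc (x₁ - x₀)) (E.enc (m₁ - m₀)) (E.enc (o₁ - o₀))) = false →
      ∃ qs, withQs (E.enc (x₁ - x₀), E.enc (m₁ - m₀), E.enc (o₁ - o₀)) qs ∈ reps) : False := by
  -- translate to the normal form; the translated sets `B' t`, `C' t` (`t = 1,2`) contain the translated `n, k, p, l`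
  obtain ⟨A', B', C', hS', hN'⟩ := exists_nf3 hS hx₀ hx₁ hx hy₀ hy₁ hy hz₀ hz₁ hz hm₀ hm₁ hm hn₀ hn₁ hn hk₀ hk₁ hk
    ho₀ ho₁ ho hp₀ hp₁ hp hl₀ hl₁ hl
  -- order the four pairs by code: re-choose (n₀,n₁), (k₀,k₁), (p₀,p₁), (l₀,l₁) if necessary
  -- Since `exists_nf3` is stated for any choice of the two named elements, we case on the code order of each pair.
  have key : ∀ {n₀ n₁ k₀ k₁ p₀ p₁ l₀ l₁ : G}, n₀ ∈ B 1 → n₁ ∈ B 1 → n₀ ≠ n₁ → k₀ ∈ B 2 → k₁ ∈ B 2 → k₀ ≠ k₁ →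
      p₀ ∈ C 1 → p₁ ∈ C 1 → p₀ ≠ p₁ → l₀ ∈ C 2 → l₁ ∈ C 2 → l₀ ≠ l₁ →
      E.enc (n₀ - (y₀ + (m₀ - x₀))) < E.enc (n₁ - (y₀ + (m₀ - x₀))) →
      E.enc (p₀ - (y₀ + (o₀ - x₀))) < E.enc (p₁ - (y₀ + (o₀ - x₀))) →
      E.enc (k₀ - (z₀ + (m₀ - x₀))) < E.enc (k₁ - (z₀ + (m₀ - x₀))) →
      E.enc (l₀ - (z₀ + (o₀ - x₀))) < E.enc (l₁ - (z₀ + (o₀ - x₀))) → False := by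
    intro n₀ n₁ k₀ k₁ p₀ p₁ l₀ l₁ hn₀ hn₁ hn hk₀ hk₁ hk hp₀ hp₁ hp hl₀ hl₁ hl h1 h2 h3 h4
    obtain ⟨A'', B'', C'', hS'', hN''⟩ := exists_nf3 hS hx₀ hx₁ hx hy₀ hy₁ hy hz₀ hz₁ hz hm₀ hm₁ hm hn₀ hn₁ hn hk₀
      hk₁ hk ho₀ ho₁ ho hp₀ hp₁ hp hl₀ hl₁ hl
    have ha0 : (x₁ - x₀ : G) ≠ 0 := sub_ne_zero.2 (Ne.symm hx)
    have hb0 : (m₁ - m₀ : G) ≠ 0 := sub_ne_zero.2 (Ne.symm hm)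
    have hc0 : (o₁ - o₀ : G) ≠ 0 := sub_ne_zero.2 (Ne.symm ho)
    obtain ⟨qs, hqs⟩ := hrep (startBad_nf E hS'' hN'' ha0 hb0 hc0)
    exact nf_contra3 E hel hs hq hS'' hN'' ha0 (sub_ne_zero.2 (Ne.symm hy)) (sub_ne_zero.2 (Ne.symm hz)) hb0 hc0
      h1 h2 h3 h4 hqs
  -- choose orientations of the four pairs by code order of the translated elements
  have tr : ∀ (w : G) {S : Finset G} {u v : G}, u ∈ S → v ∈ S → u ≠ v →
      ∃ a b : G, a ∈ S ∧ b ∈ S ∧ a ≠ b ∧ E.enc (a - w) < E.enc (b - w) := by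
    intro w S u v hu hv huv
    have hne : E.enc (u - w) ≠ E.enc (v - w) := fun e => huv (sub_left_injective (E.enc_inj e))
    rcases Nat.lt_or_gt_of_ne hne with h | h
    · exact ⟨u, v, hu, hv, huv, h⟩
    · exact ⟨v, u, hv, hu, huv.symm, h⟩
  obtain ⟨n₀', n₁', hn₀', hn₁', hn', h1⟩ := tr (y₀ + (m₀ - x₀)) hn₀ hn₁ hn
  obtain ⟨p₀', p₁', hp₀', hp₁', hp', h2⟩ := tr (y₀ + (o₀ - x₀)) hp₀ hp₁ hp
  obtain ⟨k₀', k₁', hk₀', hk₁', hk', h3⟩ := tr (z₀ + (m₀ - x₀)) hk₀ hk₁ hk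
  obtain ⟨l₀', l₁', hl₀', hl₁', hl', h4⟩ := tr (z₀ + (o₀ - x₀)) hl₀ hl₁ hl
  exact key hn₀' hn₁' hn' hk₀' hk₁' hk' hp₀' hp₁' hp' hl₀' hl₁' hl' h1 h2 h3 h4

/-- Step of the assembly: from a family whose `A 0`-difference is `a` (as `x₁ - x₀`) and the covering fact for the canonical
start of `(a, m₁ - m₀, o₁ - o₀)`, a contradiction (maps fixing `±a`, the role swap `B ↔ C`, orientations).
[cite: CohnKleinbergSzegedyUmans2005, Def. 5.1] -/
theorem contra3_of_R1 {G : Type} [AddCommGroup G] [DecidableEq G] (E : Enc3 G) {el : List ℕ}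
    (hel : ∀ g : G, E.enc g ∈ el) {reps : List (ℕ × ℕ × ℕ × List ℕ)} (hs : searchB3 E.A el reps = true)
    (hq : qcovB el reps = true) (fs : List (G →+ G)) (hinj : ∀ f ∈ fs, Function.Injective f) {a : G}
    {A B C : Fin 3 → Finset G} (hS : IsSTPP A B C) {x₀ x₁ y₀ y₁ z₀ z₁ m₀ m₁ n₀ n₁ k₀ k₁ o₀ o₁ p₀ p₁ l₀ l₁ : G}
    (hx₀ : x₀ ∈ A 0) (hx₁ : x₁ ∈ A 0) (hx : x₀ ≠ x₁) (hxa : x₁ - x₀ = a) (hy₀ : y₀ ∈ A 1) (hy₁ : y₁ ∈ A 1)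
    (hy : y₀ ≠ y₁) (hz₀ : z₀ ∈ A 2) (hz₁ : z₁ ∈ A 2) (hz : z₀ ≠ z₁) (hm₀ : m₀ ∈ B 0) (hm₁ : m₁ ∈ B 0) (hm : m₀ ≠ m₁)
    (hn₀ : n₀ ∈ B 1) (hn₁ : n₁ ∈ B 1) (hn : n₀ ≠ n₁) (hk₀ : k₀ ∈ B 2) (hk₁ : k₁ ∈ B 2) (hk : k₀ ≠ k₁)
    (ho₀ : o₀ ∈ C 0) (ho₁ : o₁ ∈ C 0) (ho : o₀ ≠ o₁) (hp₀ : p₀ ∈ C 1) (hp₁ : p₁ ∈ C 1) (hp : p₀ ≠ p₁)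
    (hl₀ : l₀ ∈ C 2) (hl₁ : l₁ ∈ C 2) (hl : l₀ ≠ l₁)
    (hC2 : startBad E.A (startCfg (canon E.toEnc fs a (m₁ - m₀) (o₁ - o₀)).1 (canon E.toEnc fs a (m₁ - m₀) (o₁ - o₀)).2.1
        (canon E.toEnc fs a (m₁ - m₀) (o₁ - o₀)).2.2) = false →
      memTriple (canon E.toEnc fs a (m₁ - m₀) (o₁ - o₀)) reps = true) : False := by
  set dB := m₁ - m₀ with hdB
  set dC := o₁ - o₀ with hdC
  obtain ⟨g, hg, hga, sw, ε₂, ε₃, ht⟩ := exists_of_mem_cands E.toEnc fs a dB dC (canon_mem_cands E.toEnc fs a dB dC)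
  have hgi : Function.Injective g := by
    rcases hg with rfl | hg
    · exact fun x y h => h
    · exact hinj g hg
  have horA : ∃ b₀ b₁ : G, b₀ ∈ (A 0).image g ∧ b₁ ∈ (A 0).image g ∧ b₀ ≠ b₁ ∧ b₁ - b₀ = a := by
    rcases hga with h | h
    · exact ⟨g x₀, g x₁, mem_image_of_mem g hx₀, mem_image_of_mem g hx₁, fun e => hx (hgi e),
        by rw [← map_sub, hxa, h]⟩
    · exact ⟨g x₁, g x₀, mem_image_of_mem g hx₁, mem_image_of_mem g hx₀, fun e => hx (hgi e).symm,
        by rw [← map_sub, ← neg_sub, hxa, map_neg, h, neg_neg]⟩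
  obtain ⟨b₀, b₁, hb₀, hb₁, hb, hba⟩ := horA
  have I : ∀ {S : Finset G} {u : G}, u ∈ S → g u ∈ S.image g := fun h => mem_image_of_mem g h
  have D : ∀ {u v : G}, u ≠ v → g u ≠ g v := fun h e => h (hgi e)
  cases sw
  · -- no swap: roles (A, B, C)
    have hS₂ : IsSTPP (fun t => (A t).image g) (fun t => (B t).image g) (fun t => (C t).image g) := hS.image g hgi
    obtain ⟨v₀, v₁, hv₀, hv₁, hv, hvd⟩ := exists_oriented (I hm₀) (I hm₁) (D hm) ε₂
    obtain ⟨s₀, s₁, hs₀, hs₁, hss, hsd⟩ := exists_oriented (I ho₀) (I ho₁) (D ho) ε₃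
    refine named_contra3 E hel hs hq hS₂ hb₀ hb₁ hb (I hy₀) (I hy₁) (D hy) (I hz₀) (I hz₁) (D hz) hv₀ hv₁ hv (I hn₀)
      (I hn₁) (D hn) (I hk₀) (I hk₁) (D hk) hs₀ hs₁ hss (I hp₀) (I hp₁) (D hp) (I hl₀) (I hl₁) (D hl) ?_
    rw [hba, hvd, hsd, ← map_sub, ← map_sub, ← hdB, ← hdC]
    simp only [cond_false] at ht
    intro h
    have ht' : canon E.toEnc fs a dB dC = (E.enc a, E.enc (sg ε₂ (g dB)), E.enc (sg ε₃ (g dC))) := ht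
    refine exists_qs_of_memTriple (reps := reps) ?_
    rw [← ht']
    refine hC2 ?_
    rw [ht']
    exact h
  · -- swap: roles (A, C, B)
    have hS₂ : IsSTPP (fun t => (A t).image g) (fun t => (C t).image g) (fun t => (B t).image g) :=
      (isSTPP_swapBC hS).image g hgi
    obtain ⟨v₀, v₁, hv₀, hv₁, hv, hvd⟩ := exists_oriented (I ho₀) (I ho₁) (D ho) ε₂
    obtain ⟨s₀, s₁, hs₀, hs₁, hss, hsd⟩ := exists_oriented (I hm₀) (I hm₁) (D hm) ε₃
    refine named_contra3 E hel hs hq hS₂ hb₀ hb₁ hb (I hy₀) (I hy₁) (D hy) (I hz₀) (I hz₁) (D hz) hv₀ hv₁ hv (I hp₀)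
      (I hp₁) (D hp) (I hl₀) (I hl₁) (D hl) hs₀ hs₁ hss (I hn₀) (I hn₁) (D hn) (I hk₀) (I hk₁) (D hk) ?_
    rw [hba, hvd, hsd, ← map_sub, ← map_sub, ← hdB, ← hdC]
    simp only [cond_true] at ht
    intro h
    have ht' : canon E.toEnc fs a dB dC = (E.enc a, E.enc (sg ε₂ (g dC)), E.enc (sg ε₃ (g dB))) := ht
    refine exists_qs_of_memTriple (reps := reps) ?_
    rw [← ht']
    refine hC2 ?_
    rw [ht']
    exact h

/-- ASSEMBLY THEOREM (`N = 3`).  Data: an encoding `E`, the code list `el` of all elements, a start list `reps` whose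
kernel search succeeded and which passes the `q₁`-coverage check, the element list `elG`, first-coordinate
representatives `R1` with injective maps `auts1`, and injective maps `stab a`; the two COVERING facts `hC1`, `hC2`
(kernel-decided per group; `canon` of `STPP222SqCover.lean` through `E.toEnc`).  Conclusion: `G` admits no three
simultaneous-TPP triples of 2-subsets. [cite: CohnKleinbergSzegedyUmans2005, Def. 5.1] -/
theorem not_exists_of_cover3 {G : Type} [AddCommGroup G] [DecidableEq G] (E : Enc3 G) (el : List ℕ)
    (hel : ∀ g : G, E.enc g ∈ el) (reps : List (ℕ × ℕ × ℕ × List ℕ)) (hs : searchB3 E.A el reps = true)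
    (hq : qcovB el reps = true) (elG : List G) (helG : ∀ x : G, x ∈ elG) (R1 : List G) (auts1 : List (G →+ G))
    (hinj1 : ∀ f ∈ auts1, Function.Injective f) (hC1 : ∀ d ∈ elG, d ≠ 0 → ∃ f ∈ auts1, f d ∈ R1 ∨ -f d ∈ R1)
    (stab : G → List (G →+ G)) (hinjS : ∀ a ∈ R1, ∀ f ∈ stab a, Function.Injective f)
    (hC2 : ∀ a ∈ R1, ∀ dB ∈ elG, ∀ dC ∈ elG, dB ≠ 0 → dC ≠ 0 →
      startBad E.A (startCfg (canon E.toEnc (stab a) a dB dC).1 (canon E.toEnc (stab a) a dB dC).2.1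
        (canon E.toEnc (stab a) a dB dC).2.2) = false → memTriple (canon E.toEnc (stab a) a dB dC) reps = true) :
    ¬ ∃ A B C : Fin 3 → Finset G, IsSTPP A B C ∧ ∀ i, (A i).card = 2 ∧ (B i).card = 2 ∧ (C i).card = 2 := by
  rintro ⟨A, B, C, hS, hcard⟩
  obtain ⟨x₀, x₁, hx, hA0⟩ := Finset.card_eq_two.1 (hcard 0).1
  obtain ⟨y₀, y₁, hy, hA1⟩ := Finset.card_eq_two.1 (hcard 1).1
  obtain ⟨z₀, z₁, hz, hA2⟩ := Finset.card_eq_two.1 (hcard 2).1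
  obtain ⟨m₀, m₁, hm, hB0⟩ := Finset.card_eq_two.1 (hcard 0).2.1
  obtain ⟨n₀, n₁, hn, hB1⟩ := Finset.card_eq_two.1 (hcard 1).2.1
  obtain ⟨k₀, k₁, hk, hB2⟩ := Finset.card_eq_two.1 (hcard 2).2.1
  obtain ⟨o₀, o₁, ho, hC0⟩ := Finset.card_eq_two.1 (hcard 0).2.2
  obtain ⟨p₀, p₁, hp, hC1'⟩ := Finset.card_eq_two.1 (hcard 1).2.2
  obtain ⟨l₀, l₁, hl, hC2'⟩ := Finset.card_eq_two.1 (hcard 2).2.2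
  have M : ∀ {S : Finset G} {u v : G}, S = {u, v} → u ∈ S ∧ v ∈ S := fun h => by subst h; simp
  have hd : x₁ - x₀ ≠ 0 := sub_ne_zero.2 (Ne.symm hx)
  obtain ⟨f, hf, hfR⟩ := hC1 (x₁ - x₀) (helG _) hd
  have hfi := hinj1 f hf
  have hS₁ : IsSTPP (fun t => (A t).image f) (fun t => (B t).image f) (fun t => (C t).image f) := hS.image f hfi
  have I : ∀ {S : Finset G} {u : G}, u ∈ S → f u ∈ S.image f := fun h => mem_image_of_mem f h
  have D : ∀ {u v : G}, u ≠ v → f u ≠ f v := fun h e => h (hfi e)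
  obtain ⟨u₀, u₁, hu₀, hu₁, hu, a, haR, hua⟩ :
      ∃ u₀ u₁ : G, u₀ ∈ (A 0).image f ∧ u₁ ∈ (A 0).image f ∧ u₀ ≠ u₁ ∧ ∃ a ∈ R1, u₁ - u₀ = a := by
    rcases hfR with h | h
    · exact ⟨f x₀, f x₁, I (M hA0).1, I (M hA0).2, D hx, _, h, by rw [map_sub]⟩
    · exact ⟨f x₁, f x₀, I (M hA0).2, I (M hA0).1, (D hx).symm, _, h, by rw [map_sub, neg_sub]⟩
  exact contra3_of_R1 E hel hs hq (stab a) (hinjS a haR) hS₁ hu₀ hu₁ hu hua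
    (I (M hA1).1) (I (M hA1).2) (D hy) (I (M hA2).1) (I (M hA2).2) (D hz) (I (M hB0).1) (I (M hB0).2) (D hm)
    (I (M hB1).1) (I (M hB1).2) (D hn) (I (M hB2).1) (I (M hB2).2) (D hk) (I (M hC0).1) (I (M hC0).2) (D ho)
    (I (M hC1').1) (I (M hC1').2) (D hp) (I (M hC2').1) (I (M hC2').2) (D hl)
    (hC2 a haR _ (helG _) _ (helG _) (sub_ne_zero.2 (D hm).symm) (sub_ne_zero.2 (D ho).symm))

end STPP222CubeNeg

end Summit.MatrixMultiplication.OmegaCensus
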